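import Mathlib
import Summits.QuantumFields.YangMills.Theorems.BalabanUVNodesN15FirstOrderDefect
import HarnessLib

/-!
# Route «BalabanUVNodes» (cluster K4 «SpineRates»), Track-A DAG node N15 = spine estimate NE2, BACKGROUND LAYER — FIRST MISSING
# ESTIMATE, part 15: THE SHIFT SPECIES — the η-defect of a TRANSLATED ARGUMENT `λ(b₊)` (the third term
# `Σ_{b∈st(x)} F′_{1,k}(i ad_{A′(b)}) λ(b₊)` of [B9] (3.52)): `𝔇(pull s′, pull s) = 𝔇(fdiff s′, fdiff s) = M_{−1_{below face}} ∘ pull π ∘ (η∇_η)`,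
# ONE factor `η` against the derivative entry of the right factor; the coefficient-times-shift operator `M_c ∘ pull s` sandwiched

Cell `pub-ymgap`, seat `pub-ymgap-dag-n15-b` (generation g3; FIRST-MISSING-ESTIMATE, HUMAN RULING D-0062; chair R424 venue; ROSTER-D0062
l.26).  `bears_on: R4∕N15`.  Filed `--supports stmt-QuantumFields-19351`.  The coefficient species typed so far (g2: S0 field, S1 nonlinear maps,
S2 differentiated coefficients; g3: matrix species 13a–c∕14) cover the COEFFICIENTS of `V′₁(A)`; the third term of (3.52) also TRANSLATES THE
ARGUMENT: `λ(b₊)`, the field at the far end of the bond.  Under the η-pairing the fine translation is by one FINE bond (`s′`), the coarse one by one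
COARSE bond (`s`), and their intertwining defect through the pull-back is NOT zero: it is the subject of this file.

WHY.  [Balaban1985BackgroundPropagators] (3.52) p. 400 (verbatim, first-hand): *«V′₁(A)λ(x) = Σ_{b∈st(x)} i[A′(b), (D^η_U λ)(b)] + i[(D^{η*}_U A)(x),
λ(x)] + Σ_{b∈st(x)} F′_{1,k}(i ad_{A′(b)}) λ(b₊)»*.  The third term is `Σ_μ M_{c_μ} ∘ pull s_μ` with `c_μ(x) = F′_{1,k}(i ad_{A′(⟨x, x+e_μ⟩)})`
and `s_μ = · + e_μ`.  THE OBSERVATION: since `pull s = fdiff s + 1` and the identity has no defect, `𝔇(pull s′, pull s) = 𝔇(fdiff s′, fdiff s)`,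
which file 1 computed EXACTLY (`…N15.DerivDefect.idef_fdiff_eq`): zero on the face bonds of the blocks, MINUS the coarse difference below them —
so `𝔇(pull s′, pull s) ∘ G = −η·M_{1_{below}} ∘ pull π ∘ (∇_η ∘ G)` is ONE factor `η` (NOT `η′`, and no staircase needed: the weight is bounded by
`1`, not by `M − 1`) against the coarse derivative entry `∇_η ∘ G` ((3.42)₂ shape).  The record `t4/T4-EST-U1a.md` §3 STEP 2 lists «multiplication
operators built from A» and «lattice derivatives»; the translated argument is the located third ingredient of (3.52), rate one by the same
mechanism.  THE PRINT USED (SHAPES only): (3.35) p. 396 (`|A| ≤ α` for the coefficient), (3.42) p. 397 (entry 2), (3.52) p. 400; [B6] (2.54) p. 233.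
Nothing of [B9] asserted.

CONTENTS (all [folklore]: linear algebra and finite sups over hypothesis-shaped data; files 1∕2∕4, `T4EtaRateDefect`, `T4EtaRateCoeffDefect` BY NAME).
* §1 EXACT: `idef_pull_eq_idef_fdiff` (`𝔇(pull s′, pull s) = 𝔇(fdiff s′, fdiff s)`, any maps), `idef_pull_shift_eq` (`= M_{0 ∣ −1} ∘ pull π ∘ fdiff s` by
  file 1), `idef_pull_shift_apply`, `idef_pull_shift_eq_fdiffN` (`= M_{0 ∣ −η} ∘ pull π ∘ ∇_η`).
* §2 MAJORANTS: `hasMaj_mulOp_below_pull` (the weight `M_{0 ∣ −η} ∘ pull π` has `diagK |η|`), `hasMaj_idef_pull_shift_comp` (`𝔇(pull s′, pull s) ∘ G ≤ |η|·K₁`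
  from `∇_η ∘ G ≤ K₁`), `hasMaj_comp_idef_pull_shift_comp` (SANDWICHED `T′ ∘ 𝔇 ∘ A ≤ m_T·|η|A₁·e^{−ρd}`), `hasMaj_comp_idef_pull_shift_comp_weighted`
  (source-weighted form under `|η| ≤ c_η·w(y′)`, the (d4)-type domination of file 4).
* §3 THE COEFFICIENT-TIMES-SHIFT OPERATOR `V = M_c ∘ pull s` (the third term's shape): `idef_coeffShift_eq` (LEIBNIZ `𝔇(M_{c′}pull s′, M_c pull s) =
  M_{c′}∘𝔇(pull s′, pull s) + 𝔇(M_{c′}, M_c)∘pull s`), `wrow_const_mul` (row norms scale), `hasMaj_comp_mulOp_left` (`T′∘M_{c′} ≤ α·N_T` from `|c′| ≤ α`),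
  **`hasMaj_comp_idef_coeffShift_comp`** (SANDWICHED: `T′ ∘ 𝔇(V′, V) ∘ A ≤ (αm_TA₁c_η + m_Tε A₀C)·e^{−ρd}·w(y′)` from `T′ ≤ N_T`, `|c′| ≤ α`, the coarse
  derivative entry `∇_η∘A ≤ A₁e^{−(ρ+σ)d}`, the SHIFTED right factor `pull s ∘ A ≤ A₀e^{−(ρ+σ)d}`, the fit `|c′ − c∘π| ≤ o ≤ εw`, `|η| ≤ c_η w`).
* §4 THE SHIFTED RIGHT FACTOR from the unshifted one: `coarseShiftKernel` (`1` iff some site of cube `y′`'s pre-image under `s` lies in cube `y`),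
  `hasMaj_pull_coarseShift` (`pull s` has that majorant between the coarse cube norms), `hasMaj_pull_comp_of_reach` (`pull s ∘ A ≤ n₀A₀e^{(ρ+σ)r₀}·e^{−(ρ+σ)d}`
  when the shift reaches at most `n₀` cubes within distance `r₀` — geometry letters, (2.54)).

HONEST FRAMING ∕ LIMITS.  MECHANISM over hypothesis-SHAPED letters; scalar model (the matrix version follows on the product carrier of part 14, where
`pull (liftMap s ι)` is again a pull-back); `U ≡ 1` shifts (no parallel transport in the translation); crude constants.  NE2⁺ NOT PRINTED, NOT proved;
count-neutral (typed 28∕28; nothing discharged); one finite T⁴ at fixed ε — NOT infinite volume, NOT OS on ℝ⁴, NOT a mass gap, NOT Clay.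
-/

noncomputable section

namespace Summit.QuantumFields.YangMills.BalabanUVNodes.N15.ShiftSpecies

open Literature.MathematicalPhysics.QuantumFieldTheory.Balaban1983to89
open Literature.MathematicalPhysics.QuantumFieldTheory.Balaban1983to89.T4EtaRateDefect (idef idef_apply idef_comp SlowWeight
  hasMaj_comp_transfer hasMaj_comp_wrow_source)
open Literature.MathematicalPhysics.QuantumFieldTheory.Balaban1983to89.T4EtaRateCoeffDefect (pull pull_apply diagK diagK_same diagK_ne
  diagK_nonneg loc_fine_mul_pull_le hasMaj_idef_mulOp_comp_transfer hasMaj_mulOp)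
open Literature.MathematicalPhysics.QuantumFieldTheory.Balaban1983to89.B11AxialTransport190 (abs_le_loc_ofBlocks loc_ofBlocks_le)
open Literature.MathematicalPhysics.QuantumFieldTheory.Balaban1983to89.B6Prop26Gluing (mulOp mulOp_apply)
open B6RandomWalk B11SectG B9SectDWeightedNeumann Finset
open Summit.QuantumFields.YangMills.BalabanUVNodes.N15.DerivDefect

/-! ## §1 The exact defect of a translated argument -/

section Exact

variable {X X' : Type}

/-- `𝔇(pull s′, pull s) = 𝔇(fdiff s′, fdiff s)`: translating the argument and taking the (unnormalised) difference have THE SAME intertwining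
defect through any pull-back pairing (`pull s = fdiff s + 1`, and the identity has none). [folklore] -/
theorem idef_pull_eq_idef_fdiff (π : X' → X) (s : X → X) (s' : X' → X') :
    idef (pull π) (pull π) (pull s') (pull s) = idef (pull π) (pull π) (fdiff s') (fdiff s) := by
  ext f x'
  simp only [idef_apply, Pi.sub_apply, pull_apply, fdiff_apply]
  ring

variable (D : LineData X X')

/-- THE EXACT SHIFT DEFECT (file 1's `idef_fdiff_eq`): `𝔇(pull s′, pull s) = M_{0 on the face ∣ −1 below} ∘ pull π ∘ fdiff s` — zero on the face
bonds (where the fine translation crosses into the next block exactly as the coarse one does), MINUS the coarse bond difference below them.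
[folklore] -/
theorem idef_pull_shift_eq :
    idef (pull D.π) (pull D.π) (pull D.s') (pull D.s) =
      mulOp (fun x' => if D.dep x' + 1 = D.M then (0 : ℝ) else -1) ∘ₗ pull D.π ∘ₗ fdiff D.s := by
  rw [idef_pull_eq_idef_fdiff]
  exact idef_fdiff_eq D

/-- Pointwise: `𝔇(pull s′, pull s) f (x′) = (0 ∣ −1)(x′)·(f(s(πx′)) − f(πx′))`. [folklore] -/
theorem idef_pull_shift_apply (f : X → ℝ) (x' : X') :
    idef (pull D.π) (pull D.π) (pull D.s') (pull D.s) f x' =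
      (if D.dep x' + 1 = D.M then (0 : ℝ) else -1) * (f (D.s (D.π x')) - f (D.π x')) := by
  rw [idef_pull_shift_eq]
  rfl

/-- WITH THE DIFFERENCE QUOTIENT: `𝔇(pull s′, pull s) = M_{0 ∣ −η} ∘ pull π ∘ ∇_η` (`η ≠ 0`) — ONE factor `η` in front of the coarse derivative.
[folklore] -/
theorem idef_pull_shift_eq_fdiffN {η : ℝ} (hη : η ≠ 0) :
    idef (pull D.π) (pull D.π) (pull D.s') (pull D.s) =
      mulOp (fun x' => if D.dep x' + 1 = D.M then (0 : ℝ) else -η) ∘ₗ pull D.π ∘ₗ fdiffN η D.s := by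
  ext f x'
  rw [idef_pull_shift_apply]
  simp only [LinearMap.comp_apply, mulOp_apply, pull_apply, fdiffN_apply]
  split_ifs
  · ring
  · field_simp

end Exact

/-! ## §2 Majorants: one factor `η` against the derivative entry of the right factor -/

section Majorant

variable {X X' : Type} [Fintype X] [Fintype X'] (D : LineData X X') {g : B6.Geometry} (blk : X → g.Site)
variable {F₁ F₃ : Type} [AddCommGroup F₁] [Module ℝ F₁] [AddCommGroup F₃] [Module ℝ F₃] {b₁ : BlockNorm g F₁} {b₃ : BlockNorm g F₃}

/-- The weight `M_{0 ∣ −η} ∘ pull π` has the diagonal majorant `diagK |η|` between the sharp cube norms (`T4EtaRateCoeffDefect.loc_fine_mul_pull_le`).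
[folklore] -/
theorem hasMaj_mulOp_below_pull (η : ℝ) :
    HasMaj (BlockNorm.ofBlocks g blk) (BlockNorm.ofBlocks g (blk ∘ D.π))
      (mulOp (fun x' => if D.dep x' + 1 = D.M then (0 : ℝ) else -η) ∘ₗ pull D.π) (diagK fun _ => |η|) := by
  intro y' μ hμ y
  have hfun : (mulOp (fun x' => if D.dep x' + 1 = D.M then (0 : ℝ) else -η) ∘ₗ pull D.π) μ =
      fun x' => (if D.dep x' + 1 = D.M then (0 : ℝ) else -η) * μ (D.π x') := rfl
  rw [hfun]
  refine loc_fine_mul_pull_le blk D.π (fun _ => abs_nonneg η) (fun x' => ?_) hμ y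
  split_ifs <;> simp

/-- `𝔇(pull s′, pull s) ∘ G ≤ |η|·K₁` into the fine cubes, from the coarse derivative entry `∇_η ∘ G ≤ K₁` (`K₁ ≥ 0`) — ONE factor `η`, no staircase.
[cite: Balaban1985BackgroundPropagators, Thm 3.1 (3.42) p.397 (second entry: shape of `K₁`)] -/
theorem hasMaj_idef_pull_shift_comp {η : ℝ} (hη : η ≠ 0) {G : F₁ →ₗ[ℝ] (X → ℝ)} {K₁ : g.Site → g.Site → ℝ}
    (hG : HasMaj b₁ (BlockNorm.ofBlocks g blk) (fdiffN η D.s ∘ₗ G) K₁) :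
    HasMaj b₁ (BlockNorm.ofBlocks g (blk ∘ D.π)) (idef (pull D.π) (pull D.π) (pull D.s') (pull D.s) ∘ₗ G)
      (fun y y' => |η| * K₁ y y') := by
  have hop : idef (pull D.π) (pull D.π) (pull D.s') (pull D.s) ∘ₗ G =
      (mulOp (fun x' => if D.dep x' + 1 = D.M then (0 : ℝ) else -η) ∘ₗ pull D.π) ∘ₗ (fdiffN η D.s ∘ₗ G) := by
    rw [idef_pull_shift_eq_fdiffN D hη]
    rfl
  rw [hop]
  have key := hasMaj_comp (hasMaj_mulOp_below_pull D blk η) hG (diagK_nonneg fun _ => abs_nonneg η)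
  have hκ : (BlockNorm.ofBlocks g blk).κ = 1 := rfl
  refine key.mono fun a b => le_of_eq ?_
  simp only [hκ, one_mul]
  exact sum_diagK_mul _ _ _

/-- SANDWICHED: `T′ ∘ 𝔇(pull s′, pull s) ∘ A ≤ m_T·(|η|A₁)·e^{−ρd(y,y′)}` from `T′ ≤ N_T` (`‖N_T‖_ρ ≤ m_T`) and `∇_η ∘ A ≤ A₁e^{−ρd}`
(`B9SectDWeightedNeumann.hasMaj_comp_wrow`). [folklore] -/
theorem hasMaj_comp_idef_pull_shift_comp {η : ℝ} (hη : η ≠ 0) (htri : Triangle254 g) {ρ A₁ m_T : ℝ} (hρ : 0 ≤ ρ) (hA₁ : 0 ≤ A₁)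
    {T' : (X' → ℝ) →ₗ[ℝ] F₃} {A : F₁ →ₗ[ℝ] (X → ℝ)} {N_T : g.Site → g.Site → ℝ} (hNT : ∀ a b, 0 ≤ N_T a b) (hmT : WRow g ρ N_T m_T)
    (hT : HasMaj (BlockNorm.ofBlocks g (blk ∘ D.π)) b₃ T' N_T)
    (hA : HasMaj b₁ (BlockNorm.ofBlocks g blk) (fdiffN η D.s ∘ₗ A) (fun y y' => A₁ * Real.exp (-(ρ * g.dist y y')))) :
    HasMaj b₁ b₃ (T' ∘ₗ idef (pull D.π) (pull D.π) (pull D.s') (pull D.s) ∘ₗ A)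
      (fun y y' => m_T * (|η| * A₁) * Real.exp (-(ρ * g.dist y y'))) := by
  have hmid : HasMaj b₁ (BlockNorm.ofBlocks g (blk ∘ D.π)) (idef (pull D.π) (pull D.π) (pull D.s') (pull D.s) ∘ₗ A)
      (fun y y' => (|η| * A₁) * Real.exp (-(ρ * g.dist y y'))) := by
    refine (hasMaj_idef_pull_shift_comp D blk hη hA).mono fun y y' => le_of_eq ?_
    ring
  have key := hasMaj_comp_wrow htri hρ (mul_nonneg (abs_nonneg η) hA₁) hNT hmT hT hmid
  have hκ' : (BlockNorm.ofBlocks g (blk ∘ D.π)).κ = 1 := rfl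
  have hop : T' ∘ₗ idef (pull D.π) (pull D.π) (pull D.s') (pull D.s) ∘ₗ A =
      T' ∘ₗ (idef (pull D.π) (pull D.π) (pull D.s') (pull D.s) ∘ₗ A) := rfl
  rw [hop]
  simpa only [hκ', one_mul] using key

/-- SOURCE-WEIGHTED FORM: if moreover the derivative entry has the better rate `ρ + σ` (`σ, d ≥ 0`) and the plain factor is dominated by the weight,
`|η| ≤ c_η·w(y′)` (`c_η = 1` for the η-rate weight `L^{−j} ≥ η`), then `T′ ∘ 𝔇(pull s′, pull s) ∘ A ≤ (m_TA₁c_η)·e^{−ρd(y,y′)}·w(y′)`. [folklore] -/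
theorem hasMaj_comp_idef_pull_shift_comp_weighted {η : ℝ} (hη : η ≠ 0) (htri : Triangle254 g) (hd : ∀ a b : g.Site, 0 ≤ g.dist a b)
    {ρ σ A₁ m_T cη : ℝ} (hρ : 0 ≤ ρ) (hσ : 0 ≤ σ) (hA₁ : 0 ≤ A₁) {w : g.Site → ℝ} (hηw : ∀ y', |η| ≤ cη * w y')
    {T' : (X' → ℝ) →ₗ[ℝ] F₃} {A : F₁ →ₗ[ℝ] (X → ℝ)} {N_T : g.Site → g.Site → ℝ} (hNT : ∀ a b, 0 ≤ N_T a b) (hmT : WRow g ρ N_T m_T)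
    (hT : HasMaj (BlockNorm.ofBlocks g (blk ∘ D.π)) b₃ T' N_T)
    (hA : HasMaj b₁ (BlockNorm.ofBlocks g blk) (fdiffN η D.s ∘ₗ A) (fun y y' => A₁ * Real.exp (-((ρ + σ) * g.dist y y')))) :
    HasMaj b₁ b₃ (T' ∘ₗ idef (pull D.π) (pull D.π) (pull D.s') (pull D.s) ∘ₗ A)
      (fun y y' => (m_T * A₁ * cη) * Real.exp (-(ρ * g.dist y y')) * w y') := by
  have hAρ : HasMaj b₁ (BlockNorm.ofBlocks g blk) (fdiffN η D.s ∘ₗ A) (fun y y' => A₁ * Real.exp (-(ρ * g.dist y y'))) :=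
    hA.mono fun y y' => mul_le_mul_of_nonneg_left (exp_rate_mono hσ (hd y y')) hA₁
  refine (hasMaj_comp_idef_pull_shift_comp D blk hη htri hρ hA₁ hNT hmT hT hAρ).mono fun y y' => ?_
  have hm0 : 0 ≤ m_T := hmT.nonneg hNT y
  have hE : 0 ≤ Real.exp (-(ρ * g.dist y y')) := Real.exp_nonneg _
  calc m_T * (|η| * A₁) * Real.exp (-(ρ * g.dist y y'))
      = (m_T * A₁ * Real.exp (-(ρ * g.dist y y'))) * |η| := by ring
    _ ≤ (m_T * A₁ * Real.exp (-(ρ * g.dist y y'))) * (cη * w y') :=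
        mul_le_mul_of_nonneg_left (hηw y') (mul_nonneg (mul_nonneg hm0 hA₁) hE)
    _ = (m_T * A₁ * cη) * Real.exp (-(ρ * g.dist y y')) * w y' := by ring

end Majorant

/-! ## §3 The coefficient-times-shift operator `V = M_c ∘ pull s`, sandwiched -/

section CoeffShift

variable {X X' : Type} (D : LineData X X')

/-- LEIBNIZ for the third term's shape: `𝔇(M_{c′}∘pull s′, M_c∘pull s) = M_{c′} ∘ 𝔇(pull s′, pull s) + 𝔇(M_{c′}, M_c) ∘ pull s`
(`T4EtaRateDefect.idef_comp`). [folklore] -/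
theorem idef_coeffShift_eq (c' : X' → ℝ) (c : X → ℝ) :
    idef (pull D.π) (pull D.π) (mulOp c' ∘ₗ pull D.s') (mulOp c ∘ₗ pull D.s) =
      mulOp c' ∘ₗ idef (pull D.π) (pull D.π) (pull D.s') (pull D.s) +
        idef (pull D.π) (pull D.π) (mulOp c') (mulOp c) ∘ₗ pull D.s :=
  idef_comp (pull D.π) (pull D.π) (pull D.π) (mulOp c') (pull D.s') (mulOp c) (pull D.s)

variable [Fintype X] [Fintype X'] {g : B6.Geometry} (blk : X → g.Site)
variable {F₁ F₃ : Type} [AddCommGroup F₁] [Module ℝ F₁] [AddCommGroup F₃] [Module ℝ F₃] {b₁ : BlockNorm g F₁} {b₃ : BlockNorm g F₃}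

omit [Fintype X] [Fintype X'] in
/-- Weighted row norms scale: `‖N‖_ρ ≤ m`, `α ≥ 0` ⟹ `‖αN‖_ρ ≤ αm`. [folklore] -/
theorem wrow_const_mul {ρ m α : ℝ} {N : g.Site → g.Site → ℝ} (hα : 0 ≤ α) (h : WRow g ρ N m) :
    WRow g ρ (fun y y' => α * N y y') (α * m) := fun y => by
  have := h y
  calc ∑ y', α * N y y' * Real.exp (ρ * g.dist y y') = α * ∑ y', N y y' * Real.exp (ρ * g.dist y y') := by
        rw [Finset.mul_sum]; exact Finset.sum_congr rfl fun y' _ => by ring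
    _ ≤ α * m := mul_le_mul_of_nonneg_left this hα

omit [Fintype X] in
/-- A bounded fine coefficient after the left factor: `T′ ≤ N_T` (`N_T ≥ 0`), `|c′| ≤ α` ⟹ `T′ ∘ M_{c′} ≤ α·N_T`. [folklore] -/
theorem hasMaj_comp_mulOp_left (blk' : X' → g.Site) {T' : (X' → ℝ) →ₗ[ℝ] F₃} {N_T : g.Site → g.Site → ℝ} {c' : X' → ℝ} {α : ℝ}
    (hNT : ∀ a b, 0 ≤ N_T a b) (hα : 0 ≤ α) (hc' : ∀ x', |c' x'| ≤ α) (hT : HasMaj (BlockNorm.ofBlocks g blk') b₃ T' N_T) :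
    HasMaj (BlockNorm.ofBlocks g blk') b₃ (T' ∘ₗ mulOp c') (fun y y' => α * N_T y y') := by
  have hm := hasMaj_mulOp (g := g) blk' (m := fun _ => α) (fun _ => hα) hc'
  have hκ : (BlockNorm.ofBlocks g blk').κ = 1 := rfl
  refine (hasMaj_comp hT hm hNT).mono fun y y' => le_of_eq ?_
  simp only [hκ, one_mul]
  rw [sum_mul_diagK]
  ring

/-- **THE THIRD TERM's SHAPE SANDWICHED.**  For `V = M_c ∘ pull s` (coarse), `V′ = M_{c′} ∘ pull s′` (fine):
`T′ ∘ 𝔇(V′, V) ∘ A ≤ (αm_TA₁c_η + m_T(εA₀C))·e^{−ρd(y,y′)}·w(y′)` from `T′ ≤ N_T` (`‖N_T‖_ρ ≤ m_T`), the coefficient size `|c′| ≤ α` ((3.35) shape), the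
coarse derivative entry `∇_η ∘ A ≤ A₁e^{−(ρ+σ)d}` ((3.42)₂ shape), the SHIFTED right factor `pull s ∘ A ≤ A₀e^{−(ρ+σ)d}` (§4 supplies it from `A`'s own
majorant), the coefficient fit `|c′ − c∘π| ≤ o ≤ ε·w` (g2's species S1 for `c = F′_{1,k}(ad A)`), and the domination `|η| ≤ c_η·w(y′)`.  Shift piece: §2;
coefficient piece: `T4EtaRateCoeffDefect.hasMaj_idef_mulOp_comp_transfer` + `T4EtaRateDefect.hasMaj_comp_wrow_source`. [folklore] -/
theorem hasMaj_comp_idef_coeffShift_comp {η : ℝ} (hη : η ≠ 0) (htri : Triangle254 g) (hd : ∀ a b : g.Site, 0 ≤ g.dist a b)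
    (hdiag : ∀ y, g.dist y y = 0) {ρ σ C ε A₀ A₁ m_T cη α : ℝ} (hρ : 0 ≤ ρ) (hσ : 0 ≤ σ) (hA₀ : 0 ≤ A₀) (hA₁ : 0 ≤ A₁) (hC : 0 ≤ C)
    (hε : 0 ≤ ε) (hα : 0 ≤ α) {w o : g.Site → ℝ} (hw : ∀ y, 0 ≤ w y) (hsw : SlowWeight g σ C w) (hηw : ∀ y', |η| ≤ cη * w y')
    (ho : ∀ y, 0 ≤ o y) (how : ∀ y, o y ≤ ε * w y)
    {c' : X' → ℝ} {c : X → ℝ} (hc' : ∀ x', |c' x'| ≤ α) (hfit : ∀ x', |c' x' - c (D.π x')| ≤ o (blk (D.π x')))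
    {T' : (X' → ℝ) →ₗ[ℝ] F₃} {A : F₁ →ₗ[ℝ] (X → ℝ)} {N_T : g.Site → g.Site → ℝ} (hNT : ∀ a b, 0 ≤ N_T a b) (hmT : WRow g ρ N_T m_T)
    (hT : HasMaj (BlockNorm.ofBlocks g (blk ∘ D.π)) b₃ T' N_T)
    (hdA : HasMaj b₁ (BlockNorm.ofBlocks g blk) (fdiffN η D.s ∘ₗ A) (fun y y' => A₁ * Real.exp (-((ρ + σ) * g.dist y y'))))
    (hsA : HasMaj b₁ (BlockNorm.ofBlocks g blk) (pull D.s ∘ₗ A) (fun y y' => A₀ * Real.exp (-((ρ + σ) * g.dist y y')))) :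
    HasMaj b₁ b₃ (T' ∘ₗ idef (pull D.π) (pull D.π) (mulOp c' ∘ₗ pull D.s') (mulOp c ∘ₗ pull D.s) ∘ₗ A)
      (fun y y' => (α * m_T * A₁ * cη + m_T * (ε * A₀ * C)) * Real.exp (-(ρ * g.dist y y')) * w y') := by
  -- Leibniz and the sandwich identity
  have hop : T' ∘ₗ idef (pull D.π) (pull D.π) (mulOp c' ∘ₗ pull D.s') (mulOp c ∘ₗ pull D.s) ∘ₗ A =
      (T' ∘ₗ mulOp c') ∘ₗ idef (pull D.π) (pull D.π) (pull D.s') (pull D.s) ∘ₗ A +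
        T' ∘ₗ (idef (pull D.π) (pull D.π) (mulOp c') (mulOp c) ∘ₗ (pull D.s ∘ₗ A)) := by
    rw [idef_coeffShift_eq]
    ext v
    simp only [LinearMap.comp_apply, LinearMap.add_apply, map_add]
  rw [hop]
  -- shift piece: the left factor `T′∘M_{c′} ≤ αN_T`, then §2
  have hTc := hasMaj_comp_mulOp_left (g := g) (b₃ := b₃) (blk ∘ D.π) hNT hα hc' hT
  have h1 := hasMaj_comp_idef_pull_shift_comp_weighted D blk (b₁ := b₁) (b₃ := b₃) hη htri hd hρ hσ hA₁ hηw
    (fun a b => mul_nonneg hα (hNT a b)) (wrow_const_mul hα hmT) hTc hdA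
  -- coefficient piece on the shifted right factor
  have hin := hasMaj_idef_mulOp_comp_transfer (b₁ := b₁) blk D.π htri hdiag hρ hA₀ hC hε hw hsw ho how hfit hsA
  have h2' := hasMaj_comp_wrow_source htri hρ (mul_nonneg (mul_nonneg hε hA₀) hC) hNT hw hmT hT hin
  have hκ' : (BlockNorm.ofBlocks g (blk ∘ D.π)).κ = 1 := rfl
  have h2 : HasMaj b₁ b₃ (T' ∘ₗ (idef (pull D.π) (pull D.π) (mulOp c') (mulOp c) ∘ₗ (pull D.s ∘ₗ A)))
      (fun y y' => m_T * (ε * A₀ * C) * Real.exp (-(ρ * g.dist y y')) * w y') := by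
    simpa only [hκ', one_mul] using h2'
  refine (h1.add h2).mono fun y y' => le_of_eq ?_
  ring

end CoeffShift

/-! ## §4 The shifted right factor from the unshifted one: the coarse shift kernel -/

section CoarseShift

variable {X : Type} [Fintype X] {g : B6.Geometry} (s : X → X) (blk : X → g.Site)

open Classical in
/-- THE COARSE SHIFT KERNEL: `K_s(y, y′) = 1` if some site `x` of the cube `y` is translated by `s` into the cube `y′`, else `0` — which cubes the
pull-back along `s` reads from. [folklore] -/
def coarseShiftKernel (y y' : g.Site) : ℝ := if ∃ x : X, blk x = y ∧ blk (s x) = y' then 1 else 0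

/-- The coarse shift kernel is non-negative. [folklore] -/
theorem coarseShiftKernel_nonneg (y y' : g.Site) : 0 ≤ coarseShiftKernel s blk y y' := by
  unfold coarseShiftKernel
  split_ifs <;> norm_num

/-- The coarse shift kernel is at most `1`. [folklore] -/
theorem coarseShiftKernel_le_one (y y' : g.Site) : coarseShiftKernel s blk y y' ≤ 1 := by
  unfold coarseShiftKernel
  split_ifs <;> norm_num

/-- **`pull s` HAS THE MAJORANT `K_s`** between the coarse cube norms: a function localised in cube `y′` is read by `pull s` only at sites `x` with
`s x` in cube `y′`, i.e. in cubes `y` with `K_s(y, y′) = 1`, at the same size. [folklore] -/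
theorem hasMaj_pull_coarseShift :
    HasMaj (BlockNorm.ofBlocks g blk) (BlockNorm.ofBlocks g blk) (pull s) (coarseShiftKernel s blk) := by
  classical
  intro y' μ hμ y
  have hμ' : ∀ x : X, blk x ≠ y' → μ x = 0 := hμ
  have hloc0 : 0 ≤ (BlockNorm.ofBlocks g blk).loc y' μ := (BlockNorm.ofBlocks g blk).loc_nonneg y' μ
  refine loc_ofBlocks_le blk _ (mul_nonneg (coarseShiftKernel_nonneg s blk y y') hloc0) fun x hx => ?_
  rw [pull_apply]
  by_cases hμ0 : μ (s x) = 0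
  · rw [hμ0, abs_zero]
    exact mul_nonneg (coarseShiftKernel_nonneg s blk y y') hloc0
  · have hy' : blk (s x) = y' := by
      by_contra hne
      exact hμ0 (hμ' (s x) hne)
    have hK : coarseShiftKernel s blk y y' = 1 := by
      unfold coarseShiftKernel
      rw [if_pos ⟨x, hx, hy'⟩]
    rw [hK, one_mul]
    exact abs_le_loc_ofBlocks blk μ hy'

variable {F₁ : Type} [AddCommGroup F₁] [Module ℝ F₁] {b₁ : BlockNorm g F₁}

/-- **THE SHIFTED RIGHT FACTOR** (binder `hsA` of §3) from the unshifted one: if `A ≤ A₀e^{−θd}` (`A₀ ≥ 0`, `θ ≥ 0`) and the shift REACHES LITTLE —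
every cube `y` has at most `n₀` cubes `y″` with `K_s(y, y″) ≠ 0`, all within `d(y, y″) ≤ r₀` — then `pull s ∘ A ≤ (n₀A₀e^{θr₀})·e^{−θd(y,y′)}` (triangle
inequality (2.54)).  Geometry letters `n₀`, `r₀`: for the unit shift of `ℤ^d` with cubes, `n₀ = 2` and `r₀` = the distance of adjacent cubes.
[cite: Balaban1984PropagatorsII, (2.54) p.233 (shape)] -/
theorem hasMaj_pull_comp_of_reach (htri : Triangle254 g) {θ A₀ r₀ : ℝ} {n₀ : ℕ} (hθ : 0 ≤ θ) (hA₀ : 0 ≤ A₀)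
    (hreach : ∀ y y'', coarseShiftKernel s blk y y'' ≠ 0 → g.dist y y'' ≤ r₀)
    (hcount : ∀ y, (Finset.univ.filter fun y'' => coarseShiftKernel s blk y y'' ≠ 0).card ≤ n₀)
    {A : F₁ →ₗ[ℝ] (X → ℝ)} (hA : HasMaj b₁ (BlockNorm.ofBlocks g blk) A (fun y y' => A₀ * Real.exp (-(θ * g.dist y y')))) :
    HasMaj b₁ (BlockNorm.ofBlocks g blk) (pull s ∘ₗ A) (fun y y' => (n₀ * A₀ * Real.exp (θ * r₀)) * Real.exp (-(θ * g.dist y y'))) := by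
  classical
  have key := hasMaj_comp (hasMaj_pull_coarseShift s blk) hA (coarseShiftKernel_nonneg s blk)
  have hκ : (BlockNorm.ofBlocks g blk).κ = 1 := rfl
  refine key.mono fun y y' => ?_
  simp only [hκ, one_mul]
  -- each reached cube contributes at most `A₀e^{θr₀}e^{−θd(y,y′)}`
  have hterm : ∀ y'', coarseShiftKernel s blk y y'' * (A₀ * Real.exp (-(θ * g.dist y'' y'))) ≤
      (if coarseShiftKernel s blk y y'' ≠ 0 then 1 else 0) * (A₀ * Real.exp (θ * r₀) * Real.exp (-(θ * g.dist y y'))) := by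
    intro y''
    by_cases h0 : coarseShiftKernel s blk y y'' = 0
    · simp [h0]
    · rw [if_pos h0]
      have hd := hreach y y'' h0
      have htri' := htri y y'' y'
      have hexp : Real.exp (-(θ * g.dist y'' y')) ≤ Real.exp (θ * r₀) * Real.exp (-(θ * g.dist y y')) := by
        rw [← Real.exp_add]
        exact Real.exp_le_exp.2 (by nlinarith)
      calc coarseShiftKernel s blk y y'' * (A₀ * Real.exp (-(θ * g.dist y'' y')))
          ≤ 1 * (A₀ * (Real.exp (θ * r₀) * Real.exp (-(θ * g.dist y y')))) :=
            mul_le_mul (coarseShiftKernel_le_one s blk y y'') (mul_le_mul_of_nonneg_left hexp hA₀)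
              (mul_nonneg hA₀ (Real.exp_nonneg _)) zero_le_one
        _ = 1 * (A₀ * Real.exp (θ * r₀) * Real.exp (-(θ * g.dist y y'))) := by ring
  calc ∑ y'', coarseShiftKernel s blk y y'' * (A₀ * Real.exp (-(θ * g.dist y'' y')))
      ≤ ∑ y'', (if coarseShiftKernel s blk y y'' ≠ 0 then 1 else 0) * (A₀ * Real.exp (θ * r₀) * Real.exp (-(θ * g.dist y y'))) :=
        Finset.sum_le_sum fun y'' _ => hterm y''
    _ = ((Finset.univ.filter fun y'' => coarseShiftKernel s blk y y'' ≠ 0).card : ℝ) *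
          (A₀ * Real.exp (θ * r₀) * Real.exp (-(θ * g.dist y y'))) := by
        rw [← Finset.sum_mul, ← Finset.sum_filter, Finset.sum_const, nsmul_eq_mul, mul_one]
    _ ≤ (n₀ : ℝ) * (A₀ * Real.exp (θ * r₀) * Real.exp (-(θ * g.dist y y'))) :=
        mul_le_mul_of_nonneg_right (by exact_mod_cast hcount y) (by positivity)
    _ = n₀ * A₀ * Real.exp (θ * r₀) * Real.exp (-(θ * g.dist y y')) := by ring

end CoarseShift

end Summit.QuantumFields.YangMills.BalabanUVNodes.N15.ShiftSpecies
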